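import Mathlib
import HarnessLib

/-!
# Crux `NT` (stmt-QuantumFields-19353), LINE φ §FH at strong coupling: the ANALYTIC JET LEMMA — a bounded holomorphic function on
# the strong-coupling disc whose real part has a two-sided real jet `c t⁸ + O(t⁹)` has real-axis derivative `8 c t⁷ + O(t⁸)`,
# with constants depending only on the bound and the radius

Fleet lead prover of crux `NT` (unit `ym-spine-19353-p1`, g24).  Generic complex analysis (Mathlib only), serving the POINTWISE form
of the strong-coupling Feynman–Hellmann calibration (`…StrongCouplingFHJet`): the torus expectations are holomorphic in the coupling on
the disc `‖β‖ < β₁` and bounded there UNIFORMLY IN THE VOLUME (tree `differentiableOn_texpect`, `norm_texpect_le`), so a two-sided real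
jet of a covariance that is uniform in the volume differentiates to a two-sided jet of its coupling-derivative, uniform in the volume.

* `taylor_tail` — Cauchy: `f` holomorphic on `ball 0 R`, `‖f‖ ≤ M` ⇒ scalar Taylor coefficients `aₙ` with `‖aₙ‖ ≤ M/(R/2)ⁿ` and the
  tail bound `‖f(z) − Σ_{n<N} aₙ zⁿ‖ ≤ 2M (‖z‖/(R/2))ᴺ` for `‖z‖ ≤ R/4` (`DifferentiableOn.hasFPowerSeriesOnBall`, `norm_cauchyPowerSeries_le`);
* `norm_deriv_tail_le` — Cauchy's estimate on the circle of radius `‖w‖` about `w`: a tail `O(‖z‖ᴺ)` has derivative `O(‖w‖ᴺ⁻¹)`;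
* `eq_zero_of_forall_abs_le_mul`, `coeff_eq_zero_of_abs_sum_le` — identification of a real jet: `|Σ_{n<N} bₙ tⁿ| ≤ K tᵐ` on `(0, δ]`
  forces `bₙ = 0` for `n < min N m`;
* **`re_deriv_jet`** — `f` holomorphic on `ball 0 R`, `‖f‖ ≤ M`, `|Re f(t) − c t⁸| ≤ K t⁹` on `(0, δ]` ⇒ `|Re f'(t) − 8 c t⁷| ≤ (2¹⁰M/(R/2)⁹) t⁸`
  for `0 < t ≤ R/8` (the constant does not see `K`, `δ`, `c`: they only identify the Taylor polynomial's real part as `c t⁸`).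

Mathlib only; THEOREMS ONLY; no `sorry`; standard axioms.  HONEST FRAMING: textbook complex analysis; nothing about Yang–Mills is
proved in this file.  `--supports stmt-QuantumFields-19353`. [folklore]
-/

set_option autoImplicit false

noncomputable section

open MeasureTheory Filter Topology Asymptotics Finset Complex Metric
open scoped BigOperators NNReal ENNReal

namespace Summit.QuantumFields.YangMills.Cruxes.NT.StrongCouplingRung.AnalyticJet


/-- **Taylor coefficients and tail of a bounded holomorphic function on a disc** (Cauchy): `‖aₙ‖ ≤ M/(R/2)ⁿ` and
`‖f z − Σ_{n<N} aₙ zⁿ‖ ≤ 2M(‖z‖/(R/2))ᴺ` for `‖z‖ ≤ R/4`. [folklore] -/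
theorem taylor_tail (f : ℂ → ℂ) {R M : ℝ} (hR : 0 < R) (hf : DifferentiableOn ℂ f (ball 0 R))
    (hM : ∀ z ∈ ball (0 : ℂ) R, ‖f z‖ ≤ M) (N : ℕ) :
    ∃ a : ℕ → ℂ, (∀ n, ‖a n‖ ≤ M / (R / 2) ^ n) ∧
      ∀ z : ℂ, ‖z‖ ≤ R / 4 → ‖f z - ∑ n ∈ Finset.range N, a n * z ^ n‖ ≤ 2 * M * (‖z‖ / (R / 2)) ^ N := by
  have hM0 : 0 ≤ M := (norm_nonneg _).trans (hM 0 (mem_ball_self hR))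
  set r : ℝ≥0 := ⟨R / 2, by positivity⟩ with hr
  have hrpos : (0 : ℝ≥0) < r := by
    rw [hr]; exact_mod_cast (show (0:ℝ) < R / 2 by positivity)
  have hrR : (r : ℝ) = R / 2 := rfl
  have hsub : closedBall (0 : ℂ) r ⊆ ball 0 R := by
    intro z hz
    rw [mem_closedBall, dist_zero_right] at hz
    rw [mem_ball, dist_zero_right]
    rw [hrR] at hz
    linarith
  have H : HasFPowerSeriesOnBall f (cauchyPowerSeries f 0 r) 0 r :=
    (hf.mono hsub).hasFPowerSeriesOnBall hrpos
  set p := cauchyPowerSeries f 0 (r : ℝ) with hp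
  -- coefficient bounds
  have hcirc : ∀ θ : ℝ, circleMap 0 (r : ℝ) θ ∈ ball (0 : ℂ) R := fun θ => by
    rw [mem_ball, dist_zero_right, norm_circleMap_zero, hrR, abs_of_pos (by positivity)]; linarith
  have hcont : Continuous fun θ : ℝ => f (circleMap 0 (r : ℝ) θ) :=
    hf.continuousOn.comp_continuous (continuous_circleMap 0 (r : ℝ)) hcirc
  have hcoef : ∀ n, ‖p n‖ ≤ M / (R / 2) ^ n := by
    intro n
    have h1 := norm_cauchyPowerSeries_le f 0 (r : ℝ) n
    have hint : ∫ θ : ℝ in (0)..2 * Real.pi, ‖f (circleMap 0 (r : ℝ) θ)‖ ≤ ∫ _ in (0)..2 * Real.pi, M :=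
      intervalIntegral.integral_mono_on (by positivity) (hcont.norm.intervalIntegrable _ _) intervalIntegrable_const
        fun θ _ => hM _ (hcirc θ)
    rw [intervalIntegral.integral_const, smul_eq_mul, sub_zero] at hint
    have habs : |(r : ℝ)|⁻¹ ^ n = 1 / (R / 2) ^ n := by
      rw [hrR, abs_of_pos (by positivity), inv_pow, one_div]
    calc ‖p n‖ ≤ ((2 * Real.pi)⁻¹ * ∫ θ : ℝ in (0)..2 * Real.pi, ‖f (circleMap 0 (r : ℝ) θ)‖) * |(r : ℝ)|⁻¹ ^ n := h1
      _ ≤ ((2 * Real.pi)⁻¹ * (2 * Real.pi * M)) * |(r : ℝ)|⁻¹ ^ n := by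
          gcongr
      _ = M / (R / 2) ^ n := by
          rw [habs]; field_simp
  refine ⟨fun n => p n fun _ => 1, fun n => ?_, fun z hz => ?_⟩
  · calc ‖p n fun _ => (1 : ℂ)‖ ≤ ‖p n‖ * ∏ _i : Fin n, ‖(1 : ℂ)‖ := (p n).le_opNorm _
      _ = ‖p n‖ := by simp
      _ ≤ M / (R / 2) ^ n := hcoef n
  · -- the series
    have hzr : ‖z‖ < (r : ℝ) := by rw [hrR]; linarith [norm_nonneg z]
    have hmem : z ∈ Metric.eball (0 : ℂ) r := by
      rw [Metric.mem_eball, edist_zero_right, enorm_lt_coe]; exact_mod_cast hzr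
    have hsum := H.hasSum hmem
    rw [zero_add] at hsum
    have hterm : ∀ n, (p n fun _ => z) = p n (fun _ => 1) * z ^ n := by
      intro n
      have := (p n).map_smul_univ (fun _ : Fin n => z) (fun _ => (1 : ℂ))
      simp only [smul_eq_mul, mul_one, Finset.prod_const, Finset.card_univ, Fintype.card_fin] at this
      rw [this, mul_comm]
    simp_rw [hterm] at hsum
    -- tail
    set q : ℝ := ‖z‖ / (R / 2) with hq
    have hq0 : 0 ≤ q := by positivity
    have hq1 : q ≤ 1 / 2 := by
      rw [hq, div_le_iff₀ (by positivity)]; linarith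
    have hbound : ∀ n, ‖p n (fun _ => 1) * z ^ n‖ ≤ M * q ^ n := by
      intro n
      rw [norm_mul, norm_pow, hq, div_pow]
      calc ‖p n fun _ => (1:ℂ)‖ * ‖z‖ ^ n ≤ M / (R / 2) ^ n * ‖z‖ ^ n := by
            gcongr
            calc ‖p n fun _ => (1 : ℂ)‖ ≤ ‖p n‖ * ∏ _i : Fin n, ‖(1 : ℂ)‖ := (p n).le_opNorm _
              _ = ‖p n‖ := by simp
              _ ≤ M / (R / 2) ^ n := hcoef n
        _ = M * (‖z‖ ^ n / (R / 2) ^ n) := by ring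
    have hq1' : q < 1 := by linarith
    set g : ℕ → ℂ := fun n => p n (fun _ => 1) * z ^ n with hg
    have hsplit : (∑ i ∈ Finset.range N, g i) + ∑' i, g (i + N) = f z := by
      rw [hsum.summable.sum_add_tsum_nat_add N, hsum.tsum_eq]
    have htail_eq : f z - ∑ n ∈ Finset.range N, p n (fun _ => 1) * z ^ n = ∑' i, g (i + N) := by
      rw [← hsplit]; ring
    rw [htail_eq]
    have hsN : Summable fun i : ℕ => g (i + N) := hsum.summable.comp_injective (add_left_injective N)
    have hgeomN : Summable fun i : ℕ => M * q ^ (i + N) := by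
      have := (summable_geometric_of_lt_one hq0 hq1').mul_left (M * q ^ N)
      refine this.congr fun i => ?_
      rw [pow_add]; ring
    calc ‖∑' i, g (i + N)‖ ≤ ∑' i, ‖g (i + N)‖ := norm_tsum_le_tsum_norm hsN.norm
      _ ≤ ∑' i, M * q ^ (i + N) := hsN.norm.tsum_le_tsum (fun i => hbound (i + N)) hgeomN
      _ = M * q ^ N * ∑' i : ℕ, q ^ i := by
          rw [← tsum_mul_left]; refine tsum_congr fun i => ?_; rw [pow_add]; ring
      _ = M * q ^ N * (1 - q)⁻¹ := by rw [tsum_geometric_of_lt_one hq0 hq1']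
      _ ≤ M * q ^ N * 2 := by
          apply mul_le_mul_of_nonneg_left _ (by positivity)
          rw [inv_le_comm₀ (by linarith) (by norm_num)]; linarith
      _ = 2 * M * q ^ N := by ring


/-- Cauchy's estimate for the Taylor tail: if `‖Q z‖ ≤ A (‖z‖/ r)^N` for `‖z‖ ≤ R/4` and `Q` is differentiable on `ball 0 R`,
then at every `w ≠ 0` with `‖w‖ ≤ R/8`: `‖Q'(w)‖ · ‖w‖ ≤ A (2‖w‖/r)^N`. [folklore] -/
theorem norm_deriv_tail_le {Q : ℂ → ℂ} {R A r : ℝ} (hR : 0 < R) (hr : 0 < r) (hQ : DifferentiableOn ℂ Q (ball 0 R)) (N : ℕ)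
    (htail : ∀ z : ℂ, ‖z‖ ≤ R / 4 → ‖Q z‖ ≤ A * (‖z‖ / r) ^ N) {w : ℂ} (hw0 : w ≠ 0) (hw : ‖w‖ ≤ R / 8) :
    ‖deriv Q w‖ * ‖w‖ ≤ A * (2 * ‖w‖ / r) ^ N := by
  have hwpos : 0 < ‖w‖ := norm_pos_iff.2 hw0
  have hA : 0 ≤ A := by
    have h := htail 0 (by simp; positivity)
    rcases N with _ | N
    · simpa using (norm_nonneg _).trans h
    · have h' := htail w (by linarith)
      have : 0 ≤ A * (‖w‖ / r) ^ (N + 1) := (norm_nonneg _).trans h'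
      exact nonneg_of_mul_nonneg_left this (by positivity)
  have hsub : closedBall w ‖w‖ ⊆ ball (0 : ℂ) R := by
    intro z hz
    rw [mem_closedBall] at hz
    rw [mem_ball, dist_zero_right]
    calc ‖z‖ = ‖(z - w) + w‖ := by ring_nf
      _ ≤ ‖z - w‖ + ‖w‖ := norm_add_le _ _
      _ ≤ ‖w‖ + ‖w‖ := by rw [← dist_eq_norm]; linarith
      _ < R := by linarith
  have hd : DiffContOnCl ℂ Q (ball w ‖w‖) := by
    refine DifferentiableOn.diffContOnCl ?_
    rw [closure_ball w hwpos.ne']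
    exact hQ.mono hsub
  have hC : ∀ z ∈ sphere w ‖w‖, ‖Q z‖ ≤ A * (2 * ‖w‖ / r) ^ N := by
    intro z hz
    rw [mem_sphere, dist_eq_norm] at hz
    have hz2 : ‖z‖ ≤ 2 * ‖w‖ := by
      calc ‖z‖ = ‖(z - w) + w‖ := by ring_nf
        _ ≤ ‖z - w‖ + ‖w‖ := norm_add_le _ _
        _ = 2 * ‖w‖ := by rw [hz]; ring
    have h := htail z (by linarith)
    refine h.trans ?_
    gcongr
  have h := Complex.norm_deriv_le_of_forall_mem_sphere_norm_le hwpos hd hC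
  rwa [le_div_iff₀ hwpos] at h

/-- If `|x| ≤ C t` for all `0 < t ≤ δ` then `x = 0`. [folklore] -/
theorem eq_zero_of_forall_abs_le_mul {x C δ : ℝ} (hδ : 0 < δ) (h : ∀ t : ℝ, 0 < t → t ≤ δ → |x| ≤ C * t) : x = 0 := by
  by_contra hx
  have hxpos : 0 < |x| := abs_pos.2 hx
  have hC : 0 < C := by
    have := h δ hδ le_rfl
    nlinarith
  set t : ℝ := min δ (|x| / (2 * C)) with ht
  have htpos : 0 < t := lt_min hδ (by positivity)
  have h1 := h t htpos (min_le_left _ _)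
  have h2 : C * t ≤ C * (|x| / (2 * C)) := mul_le_mul_of_nonneg_left (min_le_right _ _) hC.le
  have h3 : C * (|x| / (2 * C)) = |x| / 2 := by field_simp
  linarith

/-- **Identification of a jet**: if `|Σ_{n<N} bₙ tⁿ| ≤ K tᵐ` for all `0 < t ≤ δ` then `bₙ = 0` for `n < min N m`. [folklore] -/
theorem coeff_eq_zero_of_abs_sum_le :
    ∀ (m N : ℕ) (b : ℕ → ℝ) (K δ : ℝ), 0 < δ →
      (∀ t : ℝ, 0 < t → t ≤ δ → |∑ n ∈ Finset.range N, b n * t ^ n| ≤ K * t ^ m) →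
      ∀ n, n < N → n < m → b n = 0 := by
  intro m
  induction m with
  | zero => intro N b K δ _ _ n _ hn; exact absurd hn (Nat.not_lt_zero _)
  | succ m ih =>
    intro N b K δ hδ h n hnN hnm
    rcases N with _ | N
    · exact absurd hnN (Nat.not_lt_zero _)
    -- `b 0 = 0`
    have hB : ∀ t : ℝ, 0 < t → t ≤ δ →
        |∑ k ∈ Finset.range N, b (k + 1) * t ^ k| ≤ ∑ k ∈ Finset.range N, |b (k + 1)| * δ ^ k := by
      intro t ht htδ
      refine (Finset.abs_sum_le_sum_abs _ _).trans (Finset.sum_le_sum fun k _ => ?_)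
      rw [abs_mul, abs_pow, abs_of_pos ht]
      gcongr
    have hsplit : ∀ t : ℝ, ∑ k ∈ Finset.range (N + 1), b k * t ^ k = b 0 + t * ∑ k ∈ Finset.range N, b (k + 1) * t ^ k := by
      intro t
      rw [Finset.sum_range_succ', pow_zero, mul_one, Finset.mul_sum, add_comm]
      congr 1
      refine Finset.sum_congr rfl fun k _ => ?_
      rw [pow_succ]; ring
    have hb0 : b 0 = 0 := by
      refine eq_zero_of_forall_abs_le_mul hδ (C := K * δ ^ m + ∑ k ∈ Finset.range N, |b (k + 1)| * δ ^ k)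
        fun t ht htδ => ?_
      have h1 := h t ht htδ
      rw [hsplit] at h1
      have h2 := hB t ht htδ
      have htm : t ^ (m + 1) ≤ δ ^ m * t := by
        rw [pow_succ]; gcongr
      have e1 : |b 0| ≤ |b 0 + t * ∑ k ∈ Finset.range N, b (k + 1) * t ^ k| + |t * ∑ k ∈ Finset.range N, b (k + 1) * t ^ k| := by
        have := abs_sub (b 0 + t * ∑ k ∈ Finset.range N, b (k + 1) * t ^ k) (t * ∑ k ∈ Finset.range N, b (k + 1) * t ^ k)
        rwa [add_sub_cancel_right] at this
      rw [abs_mul, abs_of_pos ht] at e1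
      have hK : K * t ^ (m + 1) ≤ K * δ ^ m * t ∨ K < 0 := by
        by_cases hK : 0 ≤ K
        · left; calc K * t ^ (m + 1) ≤ K * (δ ^ m * t) := mul_le_mul_of_nonneg_left htm hK
            _ = K * δ ^ m * t := by ring
        · right; exact not_le.1 hK
      rcases hK with hK | hK
      · nlinarith
      · have : K * t ^ (m + 1) < 0 := mul_neg_of_neg_of_pos hK (by positivity)
        linarith [abs_nonneg (b 0 + t * ∑ k ∈ Finset.range N, b (k + 1) * t ^ k)]
    rcases n with _ | n
    · exact hb0
    -- shift and induct
    have h' : ∀ t : ℝ, 0 < t → t ≤ δ → |∑ k ∈ Finset.range N, b (k + 1) * t ^ k| ≤ K * t ^ m := by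
      intro t ht htδ
      have h1 := h t ht htδ
      rw [hsplit, hb0, zero_add, abs_mul, abs_of_pos ht, pow_succ] at h1
      have : t * |∑ k ∈ Finset.range N, b (k + 1) * t ^ k| ≤ t * (K * t ^ m) := by linarith
      exact le_of_mul_le_mul_left this ht
    exact ih N (fun k => b (k + 1)) K δ hδ h' n (by omega) (by omega)


/-- **Real-axis derivative jet of a bounded holomorphic function from a real two-sided jet.**  If `f` is holomorphic on
`ball 0 R` with `‖f‖ ≤ M` there and `|Re f(t) − c t⁸| ≤ K t⁹` for `0 < t ≤ δ`, then `|Re f'(t) − 8 c t⁷| ≤ (2¹⁰ M /(R/2)⁹) t⁸`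
for `0 < t ≤ R/8`. [folklore] -/
theorem re_deriv_jet {f : ℂ → ℂ} {R M c K δ : ℝ} (hR : 0 < R) (hδ : 0 < δ) (hf : DifferentiableOn ℂ f (ball 0 R))
    (hM : ∀ z ∈ ball (0 : ℂ) R, ‖f z‖ ≤ M)
    (hjet : ∀ t : ℝ, 0 < t → t ≤ δ → |(f t).re - c * t ^ 8| ≤ K * t ^ 9) :
    ∀ t : ℝ, 0 < t → t ≤ R / 8 → |(deriv f t).re - 8 * c * t ^ 7| ≤ 2 ^ 10 * M / (R / 2) ^ 9 * t ^ 8 := by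
  obtain ⟨a, ha, htail⟩ := taylor_tail f hR hf hM 9
  have hM0 : 0 ≤ M := (norm_nonneg _).trans (hM 0 (mem_ball_self hR))
  set P : ℂ → ℂ := fun z => ∑ n ∈ Finset.range 9, a n * z ^ n with hP
  -- real part of `P` on the real axis
  have hPre : ∀ t : ℝ, (P t).re = ∑ n ∈ Finset.range 9, (a n).re * t ^ n := by
    intro t
    rw [hP, Complex.re_sum]
    refine Finset.sum_congr rfl fun n _ => ?_
    rw [← Complex.ofReal_pow, Complex.re_mul_ofReal]
  -- (i) identification of the real parts of the coefficients
  set b : ℕ → ℝ := fun n => (a n).re - if n = 8 then c else 0 with hb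
  have hbsum : ∀ t : ℝ, ∑ n ∈ Finset.range 9, b n * t ^ n = (∑ n ∈ Finset.range 9, (a n).re * t ^ n) - c * t ^ 8 := by
    intro t
    simp only [hb, sub_mul, Finset.sum_sub_distrib, ite_mul, zero_mul]
    rw [Finset.sum_ite_eq' (Finset.range 9) 8 (fun n => c * t ^ n)]
    simp
  have hδ' : 0 < min δ (R / 4) := lt_min hδ (by positivity)
  have hbz : ∀ n, n < 9 → b n = 0 := by
    intro n hn
    refine coeff_eq_zero_of_abs_sum_le 9 9 b (K + 2 * M / (R / 2) ^ 9) (min δ (R / 4)) hδ' (fun t ht htδ => ?_)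
      n hn hn
    rw [hbsum]
    have h1 := hjet t ht (htδ.trans (min_le_left _ _))
    have h2 := htail (t : ℂ) (by rw [Complex.norm_real, Real.norm_eq_abs, abs_of_pos ht]; exact htδ.trans (min_le_right _ _))
    have h3 : |(f t).re - ∑ n ∈ Finset.range 9, (a n).re * t ^ n| ≤ 2 * M * (t / (R / 2)) ^ 9 := by
      rw [← hPre, ← Complex.sub_re]
      refine (Complex.abs_re_le_norm _).trans ?_
      rw [Complex.norm_real, Real.norm_eq_abs, abs_of_pos ht] at h2
      exact h2
    have h4 : 2 * M * (t / (R / 2)) ^ 9 = 2 * M / (R / 2) ^ 9 * t ^ 9 := by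
      rw [div_pow]; ring
    rw [h4] at h3
    have := abs_sub_le (∑ n ∈ Finset.range 9, (a n).re * t ^ n) (f ↑t).re (c * t ^ 8)
    rw [abs_sub_comm] at h3
    calc |∑ n ∈ Finset.range 9, (a n).re * t ^ n - c * t ^ 8|
        ≤ |∑ n ∈ Finset.range 9, (a n).re * t ^ n - (f ↑t).re| + |(f ↑t).re - c * t ^ 8| := this
      _ ≤ 2 * M / (R / 2) ^ 9 * t ^ 9 + K * t ^ 9 := add_le_add h3 h1
      _ = (K + 2 * M / (R / 2) ^ 9) * t ^ 9 := by ring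
  have hare : ∀ n, n < 9 → (a n).re = if n = 8 then c else 0 := fun n hn => by
    have := hbz n hn; rw [hb] at this; linarith
  -- (ii) derivative of `P`
  intro t ht htR
  have hPd : HasDerivAt P (∑ n ∈ Finset.range 9, a n * ((n : ℂ) * (t : ℂ) ^ (n - 1))) t := by
    rw [hP]
    exact HasDerivAt.fun_sum fun n _ => (hasDerivAt_pow n (t : ℂ)).const_mul (a n)
  have hPd_re : (∑ n ∈ Finset.range 9, a n * ((n : ℂ) * (t : ℂ) ^ (n - 1))).re = 8 * c * t ^ 7 := by
    rw [Complex.re_sum]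
    have hterm : ∀ n ∈ Finset.range 9, (a n * ((n : ℂ) * (t : ℂ) ^ (n - 1))).re = (if n = 8 then c else 0) * (n * t ^ (n - 1)) := by
      intro n hn
      rw [← hare n (Finset.mem_range.1 hn)]
      have : ((n : ℂ) * (t : ℂ) ^ (n - 1)) = ((n * t ^ (n - 1) : ℝ) : ℂ) := by push_cast; ring
      rw [this, Complex.re_mul_ofReal]
    rw [Finset.sum_congr rfl hterm]
    simp only [ite_mul, zero_mul]
    rw [Finset.sum_ite_eq' (Finset.range 9) 8]
    norm_num
    ring
  -- (iii) the tail and its derivative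
  set Q : ℂ → ℂ := fun z => f z - P z with hQ
  have hPdiff : Differentiable ℂ P := by
    rw [hP]; fun_prop
  have hQd : DifferentiableOn ℂ Q (ball 0 R) := hf.sub hPdiff.differentiableOn
  have htailQ : ∀ z : ℂ, ‖z‖ ≤ R / 4 → ‖Q z‖ ≤ 2 * M * (‖z‖ / (R / 2)) ^ 9 := fun z hz => htail z hz
  have ht0 : (t : ℂ) ≠ 0 := by exact_mod_cast ht.ne'
  have htn : ‖(t : ℂ)‖ = t := by rw [Complex.norm_real, Real.norm_eq_abs, abs_of_pos ht]
  have hQ' := norm_deriv_tail_le hR (by positivity : (0:ℝ) < R / 2) hQd 9 htailQ ht0 (by rw [htn]; exact htR)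
  rw [htn] at hQ'
  -- (iv) `deriv f = P' + deriv Q`
  have hft : HasDerivAt f (deriv f t) t :=
    (hf.differentiableAt (isOpen_ball.mem_nhds (by rw [mem_ball, dist_zero_right, htn]; linarith))).hasDerivAt
  have hQt : HasDerivAt Q (deriv f t - ∑ n ∈ Finset.range 9, a n * ((n : ℂ) * (t : ℂ) ^ (n - 1))) t :=
    hft.sub hPd
  have hderQ : deriv Q t = deriv f t - ∑ n ∈ Finset.range 9, a n * ((n : ℂ) * (t : ℂ) ^ (n - 1)) := hQt.deriv
  have hkey : (deriv f t).re - 8 * c * t ^ 7 = (deriv Q t).re := by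
    rw [hderQ, Complex.sub_re, hPd_re]
  rw [hkey]
  refine (Complex.abs_re_le_norm _).trans ?_
  have hbound : ‖deriv Q ↑t‖ ≤ 2 * M * (2 * t / (R / 2)) ^ 9 / t := by
    rw [le_div_iff₀ ht]; exact hQ'
  refine hbound.trans (le_of_eq ?_)
  field_simp

end Summit.QuantumFields.YangMills.Cruxes.NT.StrongCouplingRung.AnalyticJet

end
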